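import Summits.QuantumFields.YangMills.Theorems.ColdStartUniversalityLindebergSwapColdNeighbourhood
import Summits.QuantumFields.YangMills.Theorems.ColdStartUniversalityLindebergSwapColdWindow
import HarnessLib

/-!
# Crux `ColdStartContinuumCauchy` (stmt-QuantumFields-24810, route `ColdStartUniversality`), LINE 3 «lindeberg_swap»:
# THE COLD NEIGHBOURHOOD, II — THE FINE MODULUS THROUGH `stepDown` AND THE TWO NEAR-COLD EXPECTATION ESTIMATES

Helper file (seat `ym-line-csu-p1`, g9; `--supports stmt-QuantumFields-24810`).  Brick (v1) part II of the proof plan for the registered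
rung `stub_shortWindowSwap` (plan v4 on the crux): the regime `t₀ < ε' t₁` of the assembly, where the fine process sits near the cold
configuration.  Building on part I (`exists_coarse_cold_modulus`, `hsDist_le_two_mul_add`, `exists_modulus_of_continuousOn`):

* `exists_open_one_continuousOn_stepDown` — an open set around the fine cold configuration on which `stepDown K` is continuous;
* `exists_stepDown_ball` — `stepDown` maps a small cold fine ball into any prescribed cold coarse ball;
* `exists_fine_cold_modulus` — `∃ r ρ > 0`: `D(y,1) ≤ r`, `D(z,1) ≤ r`, `D(z,y) < ρ ⇒ wdisc_K(stepDown z, stepDown y) < η`;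
* `integral_wdisc_le_near_one` — COARSE near-cold estimate: for `x` in a cold coarse ball and EVERY coarse solution family on any space,
  `E wdisc_K(V x_h, x) ≤ η + C (h² + h)`;
* `integral_wdisc_stepDown_le_near_one` — FINE near-cold estimate: for `y` in a cold fine ball and EVERY fine solution family,
  `E wdisc_K(stepDown (V' y_h), stepDown y) ≤ η + C (h² + h)`,
with `C` independent of the point, the family and the realisation (uniform stochastic continuity `measureReal_hsDist_start_ge_le`,
the bounded weight `wdisc ≤ 4`, `integral_le_add_mul_measureReal`).  THEOREMS ONLY, no sorry.  HONEST FRAMING: plumbing; no crux, rung or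
summit is proved; the Yang–Mills mass gap is NOT proved.
-/

set_option autoImplicit false

noncomputable section

namespace Summit.QuantumFields.YangMills.Cruxes.ColdStartContinuumCauchy.LindebergSwap

open scoped BigOperators Topology NNReal ENNReal
open MeasureTheory Filter Set Function
open Literature.MathematicalPhysics.QuantumFieldTheory
open Literature.MathematicalPhysics.QuantumFieldTheory.Balaban1983to89
open Literature.MathematicalPhysics.QuantumLattice
open Literature.MathematicalPhysics.QuantumFieldTheory.Balaban1983to89.BlockAveraging (blockAvg blockAvg_avg avgFun loopHol Idx)
open Summit.QuantumFields.BalabanUV.T4Continuum.SubstrateBlockAvgContinuity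
  (NestedSmall continuousOn_iter_blockAvg continuous_dist1_SU smallContinuous_expMeanLogSU)

variable (F : T3ContinuumYM3Torus.T3Family)

/-! ## §1 `stepDown` is continuous on an open set around the fine cold configuration -/

/-- **An open neighbourhood of the fine cold configuration on which `stepDown K` is continuous** (one guarded averaging step is
continuous on the interior of the first nested small-loop class). [cite: Balaban1987RG1, (0.4) p.253] -/
theorem exists_open_one_continuousOn_stepDown (K : ℕ) :
    ∃ O : Set (GaugeConfig 3 ((F.P (K + 1)).sitesPerDir 0) G2), IsOpen O ∧ (fun _ => (1 : G2)) ∈ O ∧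
      ContinuousOn (stepDown F K) O := by
  have hδ : (avSU).δ / 2 < (avSU).δ := half_lt_self (avSU).δ_pos
  obtain ⟨O₁, hO₁, h1, hsub⟩ := exists_open_one_subset_nestedSmall (F.P (K + 1)) (half_pos (avSU).δ_pos) hδ 1
  have hco : ContinuousOn (Averaging.iter (fun i => (blockAvg (P := F.P (K + 1)) (j := i) avSU : Averaging (F.P (K + 1)) i G2)) 1) O₁ :=
    (continuousOn_iter_blockAvg avSU continuous_dist1_SU smallContinuous_expMeanLogSU hδ 1).mono hsub
  refine ⟨toField F (K + 1) ⁻¹' O₁, hO₁.preimage (continuous_toField F (K + 1)), ?_, ?_⟩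
  · show toField F (K + 1) (fun _ => 1) ∈ O₁
    rw [toField_one]; exact h1
  · have hrel : Continuous fun (V : GaugeField (F.P (K + 1)) 1 G2) (e : Edge 3 ((F.P K).sitesPerDir 0)) =>
        V ⟨siteDown F K e.1, e.2⟩ := continuous_pi fun _ => continuous_apply _
    have heq : stepDown F K = (fun (V : GaugeField (F.P (K + 1)) 1 G2) (e : Edge 3 ((F.P K).sitesPerDir 0)) =>
        V ⟨siteDown F K e.1, e.2⟩) ∘
        (Averaging.iter (fun i => (blockAvg (P := F.P (K + 1)) (j := i) avSU : Averaging (F.P (K + 1)) i G2)) 1 ∘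
          toField F (K + 1)) := by
      funext c e
      simp only [Function.comp_apply, stepDown]
      rfl
    rw [heq]
    exact hrel.comp_continuousOn (hco.comp (continuous_toField F (K + 1)).continuousOn fun u hu => hu)

/-- **`stepDown` maps a small cold fine ball into any cold coarse ball.** [folklore] -/
theorem exists_stepDown_ball (K : ℕ) {r : ℝ} (hr : 0 < r) :
    ∃ r' : ℝ, 0 < r' ∧ ∀ y : GaugeConfig 3 ((F.P (K + 1)).sitesPerDir 0) G2,
      (∑ e, hsForm 2 ((fundamentalRep (Fin 2) (y e) : Matrix (Fin 2) (Fin 2) ℂ) - fundamentalRep (Fin 2) (1 : G2))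
          ((fundamentalRep (Fin 2) (y e) : Matrix (Fin 2) (Fin 2) ℂ) - fundamentalRep (Fin 2) (1 : G2))) ≤ r' →
      (∑ e, hsForm 2 ((fundamentalRep (Fin 2) (stepDown F K y e) : Matrix (Fin 2) (Fin 2) ℂ) - fundamentalRep (Fin 2) (1 : G2))
          ((fundamentalRep (Fin 2) (stepDown F K y e) : Matrix (Fin 2) (Fin 2) ℂ) - fundamentalRep (Fin 2) (1 : G2))) ≤ r := by
  haveI := Summit.QuantumFields.YangMills.Theorems.ColdStartUniversality.secondCountableTopology_su2
  haveI := Summit.QuantumFields.YangMills.Theorems.ColdStartUniversality.borelSpace_config ((F.P K).sitesPerDir 0)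
  -- `D(stepDown ·, 1)` is continuous at `1` with value `0`
  have hDc : Continuous fun x : GaugeConfig 3 ((F.P K).sitesPerDir 0) G2 => ∑ e, hsForm 2
      ((fundamentalRep (Fin 2) (x e) : Matrix (Fin 2) (Fin 2) ℂ) - fundamentalRep (Fin 2) (1 : G2))
      ((fundamentalRep (Fin 2) (x e) : Matrix (Fin 2) (Fin 2) ℂ) - fundamentalRep (Fin 2) (1 : G2)) :=
    Summit.QuantumFields.YangMills.Theorems.ColdStartUniversality.continuous_hsDist continuous_id
      (continuous_const (y := fun _ => (1 : G2)))
  have hSD := continuousAt_stepDown_one F K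
  have hcomp : ContinuousAt (fun y : GaugeConfig 3 ((F.P (K + 1)).sitesPerDir 0) G2 => ∑ e, hsForm 2
      ((fundamentalRep (Fin 2) (stepDown F K y e) : Matrix (Fin 2) (Fin 2) ℂ) - fundamentalRep (Fin 2) (1 : G2))
      ((fundamentalRep (Fin 2) (stepDown F K y e) : Matrix (Fin 2) (Fin 2) ℂ) - fundamentalRep (Fin 2) (1 : G2)))
      (fun _ => 1) := hDc.continuousAt.comp hSD
  have h0 : (∑ e, hsForm 2
      ((fundamentalRep (Fin 2) (stepDown F K (fun _ => (1 : G2)) e) : Matrix (Fin 2) (Fin 2) ℂ) - fundamentalRep (Fin 2) (1 : G2))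
      ((fundamentalRep (Fin 2) (stepDown F K (fun _ => (1 : G2)) e) : Matrix (Fin 2) (Fin 2) ℂ) - fundamentalRep (Fin 2) (1 : G2)))
      = 0 := by
    rw [StepDown.stepDown_one]; simp
  have hev : ∀ᶠ y in 𝓝 (fun _ => (1 : G2)), (∑ e, hsForm 2
      ((fundamentalRep (Fin 2) (stepDown F K y e) : Matrix (Fin 2) (Fin 2) ℂ) - fundamentalRep (Fin 2) (1 : G2))
      ((fundamentalRep (Fin 2) (stepDown F K y e) : Matrix (Fin 2) (Fin 2) ℂ) - fundamentalRep (Fin 2) (1 : G2))) < r := by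
    have h := hcomp.tendsto
    rw [h0] at h
    exact (tendsto_order.1 h).2 r hr
  obtain ⟨O, hOsub, hO, h1⟩ := mem_nhds_iff.1 hev
  obtain ⟨r₀, hr₀, hball⟩ := exists_hsDist_lt_subset hO h1
  refine ⟨r₀ / 2, half_pos hr₀, fun y hy => le_of_lt (hOsub (hball y (by linarith)))⟩

/-! ## §2 The fine cold modulus -/

/-- **The fine cold modulus**: for every `η > 0` there are `r, ρ > 0` such that `wdisc_K(stepDown z, stepDown y) < η` whenever `y, z` lie
in the closed fine cold ball of radius `r` and `D(z, y) < ρ`. [folklore] -/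
theorem exists_fine_cold_modulus (K : ℕ) {η : ℝ} (hη : 0 < η) :
    ∃ r : ℝ, 0 < r ∧ ∃ ρ : ℝ, 0 < ρ ∧ ∀ y z : GaugeConfig 3 ((F.P (K + 1)).sitesPerDir 0) G2,
      (∑ e, hsForm 2 ((fundamentalRep (Fin 2) (y e) : Matrix (Fin 2) (Fin 2) ℂ) - fundamentalRep (Fin 2) (1 : G2))
          ((fundamentalRep (Fin 2) (y e) : Matrix (Fin 2) (Fin 2) ℂ) - fundamentalRep (Fin 2) (1 : G2))) ≤ r →
      (∑ e, hsForm 2 ((fundamentalRep (Fin 2) (z e) : Matrix (Fin 2) (Fin 2) ℂ) - fundamentalRep (Fin 2) (1 : G2))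
          ((fundamentalRep (Fin 2) (z e) : Matrix (Fin 2) (Fin 2) ℂ) - fundamentalRep (Fin 2) (1 : G2))) ≤ r →
      (∑ e, hsForm 2 ((fundamentalRep (Fin 2) (z e) : Matrix (Fin 2) (Fin 2) ℂ) - fundamentalRep (Fin 2) (y e))
          ((fundamentalRep (Fin 2) (z e) : Matrix (Fin 2) (Fin 2) ℂ) - fundamentalRep (Fin 2) (y e))) < ρ →
      wdisc F K (stepDown F K z) (stepDown F K y) < η := by
  haveI := Summit.QuantumFields.YangMills.Theorems.ColdStartUniversality.secondCountableTopology_su2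
  haveI := Summit.QuantumFields.YangMills.Theorems.ColdStartUniversality.borelSpace_config ((F.P K).sitesPerDir 0)
  haveI := Summit.QuantumFields.YangMills.Theorems.ColdStartUniversality.borelSpace_config ((F.P (K + 1)).sitesPerDir 0)
  -- the coarse modulus and a fine ball mapped into the coarse ball
  obtain ⟨rc, hrc, ρc, hρc, hmodc⟩ := exists_coarse_cold_modulus F K hη
  obtain ⟨r₁, hr₁, hball₁⟩ := exists_stepDown_ball F K hrc
  -- `stepDown` is continuous on an open set around `1`; shrink to a compact fine ball inside it
  obtain ⟨O, hO, h1, hco⟩ := exists_open_one_continuousOn_stepDown F K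
  have hDc : Continuous fun y : GaugeConfig 3 ((F.P (K + 1)).sitesPerDir 0) G2 => ∑ e, hsForm 2
      ((fundamentalRep (Fin 2) (y e) : Matrix (Fin 2) (Fin 2) ℂ) - fundamentalRep (Fin 2) (1 : G2))
      ((fundamentalRep (Fin 2) (y e) : Matrix (Fin 2) (Fin 2) ℂ) - fundamentalRep (Fin 2) (1 : G2)) :=
    Summit.QuantumFields.YangMills.Theorems.ColdStartUniversality.continuous_hsDist continuous_id
      (continuous_const (y := fun _ => (1 : G2)))
  obtain ⟨r₀, hr₀, hball₀⟩ := exists_hsDist_lt_subset hO h1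
  obtain ⟨r, hrdef⟩ : ∃ r : ℝ, r = min (r₀ / 2) r₁ := ⟨_, rfl⟩
  have hr1 : r ≤ r₀ / 2 := hrdef ▸ min_le_left _ _
  have hr2 : r ≤ r₁ := hrdef ▸ min_le_right _ _
  have hrpos : 0 < r := hrdef ▸ lt_min (half_pos hr₀) hr₁
  let Kf : Set (GaugeConfig 3 ((F.P (K + 1)).sitesPerDir 0) G2) := {y | (∑ e, hsForm 2
      ((fundamentalRep (Fin 2) (y e) : Matrix (Fin 2) (Fin 2) ℂ) - fundamentalRep (Fin 2) (1 : G2))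
      ((fundamentalRep (Fin 2) (y e) : Matrix (Fin 2) (Fin 2) ℂ) - fundamentalRep (Fin 2) (1 : G2))) ≤ r}
  have hKfO : Kf ⊆ O := fun y hy => hball₀ y (by
    have h' : _ ≤ r := hy
    exact lt_of_le_of_lt h' (lt_of_le_of_lt hr1 (by linarith)))
  have hKcpt : IsCompact Kf := (isClosed_le hDc continuous_const).isCompact
  -- `Φ(y, z) = D(stepDown z, stepDown y)` is continuous on `Kf × Kf` and vanishes on the diagonal
  let Φ : GaugeConfig 3 ((F.P (K + 1)).sitesPerDir 0) G2 × GaugeConfig 3 ((F.P (K + 1)).sitesPerDir 0) G2 → ℝ := fun p =>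
    ∑ e, hsForm 2 ((fundamentalRep (Fin 2) (stepDown F K p.2 e) : Matrix (Fin 2) (Fin 2) ℂ) - fundamentalRep (Fin 2) (stepDown F K p.1 e))
      ((fundamentalRep (Fin 2) (stepDown F K p.2 e) : Matrix (Fin 2) (Fin 2) ℂ) - fundamentalRep (Fin 2) (stepDown F K p.1 e))
  have hΦc : ContinuousOn Φ (Kf ×ˢ Kf) := by
    have h2 : ContinuousOn (fun p : GaugeConfig 3 ((F.P (K + 1)).sitesPerDir 0) G2 × GaugeConfig 3 ((F.P (K + 1)).sitesPerDir 0) G2 =>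
        stepDown F K p.2) (Kf ×ˢ Kf) := (hco.mono hKfO).comp continuous_snd.continuousOn fun p hp => hp.2
    have h1' : ContinuousOn (fun p : GaugeConfig 3 ((F.P (K + 1)).sitesPerDir 0) G2 × GaugeConfig 3 ((F.P (K + 1)).sitesPerDir 0) G2 =>
        stepDown F K p.1) (Kf ×ˢ Kf) := (hco.mono hKfO).comp continuous_fst.continuousOn fun p hp => hp.1
    have hD2 : Continuous fun q : GaugeConfig 3 ((F.P K).sitesPerDir 0) G2 × GaugeConfig 3 ((F.P K).sitesPerDir 0) G2 => ∑ e, hsForm 2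
        ((fundamentalRep (Fin 2) (q.1 e) : Matrix (Fin 2) (Fin 2) ℂ) - fundamentalRep (Fin 2) (q.2 e))
        ((fundamentalRep (Fin 2) (q.1 e) : Matrix (Fin 2) (Fin 2) ℂ) - fundamentalRep (Fin 2) (q.2 e)) :=
      Summit.QuantumFields.YangMills.Theorems.ColdStartUniversality.continuous_hsDist continuous_fst continuous_snd
    have hpair := h2.prodMk h1'
    have hcomp := hD2.comp_continuousOn hpair
    exact hcomp
  have hΦ0 : ∀ y ∈ Kf, Φ (y, y) = 0 := fun y _ => by simp [Φ]
  let d : GaugeConfig 3 ((F.P (K + 1)).sitesPerDir 0) G2 × GaugeConfig 3 ((F.P (K + 1)).sitesPerDir 0) G2 → ℝ := fun p => ∑ e, hsForm 2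
      ((fundamentalRep (Fin 2) (p.2 e) : Matrix (Fin 2) (Fin 2) ℂ) - fundamentalRep (Fin 2) (p.1 e))
      ((fundamentalRep (Fin 2) (p.2 e) : Matrix (Fin 2) (Fin 2) ℂ) - fundamentalRep (Fin 2) (p.1 e))
  have hdc : Continuous d :=
    Summit.QuantumFields.YangMills.Theorems.ColdStartUniversality.continuous_hsDist continuous_snd continuous_fst
  have hdsep : ∀ y z : GaugeConfig 3 ((F.P (K + 1)).sitesPerDir 0) G2, d (y, z) = 0 → y = z := fun y z h =>
    (Summit.QuantumFields.YangMills.Theorems.ColdStartUniversality.eq_of_hsDist_eq_zero h).symm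
  have hdnn : ∀ p, 0 ≤ d p := fun p => Summit.QuantumFields.YangMills.Theorems.ColdStartUniversality.hsDist_nonneg _ _
  obtain ⟨ρ, hρ, hmod⟩ := exists_modulus_of_continuousOn hKcpt hΦc hΦ0 hdc hdsep hdnn hρc
  refine ⟨r, hrpos, ρ, hρ, fun y z hy hz hzy => ?_⟩
  have hyK : y ∈ Kf := hy
  have hzK : z ∈ Kf := hz
  have hy₁ : _ ≤ r₁ := hy.trans hr2
  have hz₁ : _ ≤ r₁ := hz.trans hr2
  exact hmodc (stepDown F K y) (stepDown F K z) (hball₁ y hy₁) (hball₁ z hz₁) (hmod y hyK z hzK hzy)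

/-! ## §3 The two near-cold expectation estimates -/

/-- **COARSE near-cold estimate**: for every `η > 0` there are `r > 0` and `C ≥ 0` such that for every coarse configuration `x` with
`D(x, 1) ≤ r`, EVERY jointly measurable... (indeed every) coarse SZZ solution `U` from `x` on any space and every lattice time `h`,
`E wdisc_K(U_h, x) ≤ η + C (h² + h)`. [folklore] -/
theorem integral_wdisc_le_near_one (γ : ℝ) (K : ℕ) {η : ℝ} (hη : 0 < η) :
    ∃ r : ℝ, 0 < r ∧ ∃ C : ℝ, 0 ≤ C ∧ ∀ (x : GaugeConfig 3 ((F.P K).sitesPerDir 0) G2),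
      (∑ e, hsForm 2 ((fundamentalRep (Fin 2) (x e) : Matrix (Fin 2) (Fin 2) ℂ) - fundamentalRep (Fin 2) (1 : G2))
          ((fundamentalRep (Fin 2) (x e) : Matrix (Fin 2) (Fin 2) ℂ) - fundamentalRep (Fin 2) (1 : G2))) ≤ r →
      ∀ (Ω : Type) [MeasurableSpace Ω] (P : Measure Ω) [IsProbabilityMeasure P]
        (W : ℝ≥0 → Ω → (Edge 3 ((F.P K).sitesPerDir 0) × NoiseIdx 2 → ℝ)) (hW : IsFlatBrownian W P)
        (U : ℝ≥0 → Ω → GaugeConfig 3 ((F.P K).sitesPerDir 0) G2), (∀ ω, U 0 ω = x) →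
        (latticeLangevinDynamics su2Rep ((γ * (F.P K).eps)⁻¹ / 2)).IsSolution (fundamentalRep (Fin 2)) hW.natFiltration P W U →
        ∀ h : ℝ≥0, ∫ ω, wdisc F K (U h ω) x ∂P ≤ η + C * (((h : ℝ) ^ 2) + h) := by
  haveI := Summit.QuantumFields.YangMills.Theorems.ColdStartUniversality.secondCountableTopology_su2
  haveI := Summit.QuantumFields.YangMills.Theorems.ColdStartUniversality.borelSpace_config ((F.P K).sitesPerDir 0)
  obtain ⟨rc, hrc, ρc, hρc, hmodc⟩ := exists_coarse_cold_modulus F K hη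
  obtain ⟨Cc, hCc0, hCc⟩ := Summit.QuantumFields.YangMills.Theorems.ColdStartUniversality.measureReal_hsDist_start_ge_le
    ((F.P K).sitesPerDir 0) ((γ * (F.P K).eps)⁻¹ / 2)
  -- radius `rc/4` for the start, closeness `min ρc (rc/4)`: then the moved point is in the `rc`-ball (quasi-triangle)
  obtain ⟨ρ', hρ'def⟩ : ∃ ρ' : ℝ, ρ' = min ρc (rc / 4) := ⟨_, rfl⟩
  have hρ'1 : ρ' ≤ ρc := hρ'def ▸ min_le_left _ _
  have hρ'2 : ρ' ≤ rc / 4 := hρ'def ▸ min_le_right _ _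
  have hρ'pos : 0 < ρ' := hρ'def ▸ lt_min hρc (by linarith)
  refine ⟨rc / 4, by linarith, 4 * (Cc / ρ'), by positivity, ?_⟩
  intro x hx Ω mΩ P hP W hW U hU0 hU h
  have hmU : Measurable (U h) := (hU.adapted h).mono (hW.natFiltration.le h) le_rfl
  -- the weight `z ↦ wdisc(z, x)` is small when `D(z, x) < ρ'`
  have hsmall : ∀ z : GaugeConfig 3 ((F.P K).sitesPerDir 0) G2,
      (∑ e, hsForm 2 ((fundamentalRep (Fin 2) (z e) : Matrix (Fin 2) (Fin 2) ℂ) - fundamentalRep (Fin 2) (x e))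
          ((fundamentalRep (Fin 2) (z e) : Matrix (Fin 2) (Fin 2) ℂ) - fundamentalRep (Fin 2) (x e))) < ρ' →
        wdisc F K z x < η := by
    intro z hz
    have hz1 := hsDist_le_two_mul_add z x (fun _ => (1 : G2))
    have hzball : (∑ e, hsForm 2 ((fundamentalRep (Fin 2) (z e) : Matrix (Fin 2) (Fin 2) ℂ) - fundamentalRep (Fin 2) (1 : G2))
        ((fundamentalRep (Fin 2) (z e) : Matrix (Fin 2) (Fin 2) ℂ) - fundamentalRep (Fin 2) (1 : G2))) ≤ rc := by
      have h4 : _ < rc / 4 := lt_of_lt_of_le hz hρ'2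
      linarith
    exact hmodc x z (hx.trans (by linarith)) hzball (lt_of_lt_of_le hz hρ'1)
  have hwm0 := (measurable_wdisc' F K).comp
    (measurable_id.prodMk (measurable_const (β := GaugeConfig 3 ((F.P K).sitesPerDir 0) G2) (a := x)))
  have hwm : Measurable fun z : GaugeConfig 3 ((F.P K).sitesPerDir 0) G2 => wdisc F K z x := hwm0
  have hdm : Measurable fun z : GaugeConfig 3 ((F.P K).sitesPerDir 0) G2 => ∑ e, hsForm 2
      ((fundamentalRep (Fin 2) (z e) : Matrix (Fin 2) (Fin 2) ℂ) - fundamentalRep (Fin 2) (x e))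
      ((fundamentalRep (Fin 2) (z e) : Matrix (Fin 2) (Fin 2) ℂ) - fundamentalRep (Fin 2) (x e)) :=
    (Summit.QuantumFields.YangMills.Theorems.ColdStartUniversality.continuous_hsDist continuous_id
      (continuous_const (y := x))).measurable
  have hE := integral_le_add_mul_measureReal (P := P) hmU hwm hdm (fun z => (wdisc_nonneg_le_four F K z x).1)
    (fun z => (wdisc_nonneg_le_four F K z x).2) hη.le hsmall
  have hT := hCc x Ω P W hW U hU0 hU h ρ' hρ'pos
  calc ∫ ω, wdisc F K (U h ω) x ∂P ≤ η + 4 * P.real {ω | ρ' ≤ ∑ e, hsForm 2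
        ((fundamentalRep (Fin 2) (U h ω e) : Matrix (Fin 2) (Fin 2) ℂ) - fundamentalRep (Fin 2) (x e))
        ((fundamentalRep (Fin 2) (U h ω e) : Matrix (Fin 2) (Fin 2) ℂ) - fundamentalRep (Fin 2) (x e))} := hE
    _ ≤ η + 4 * (Cc * (((h : ℝ) ^ 2) + h) / ρ') := by gcongr
    _ = η + 4 * (Cc / ρ') * (((h : ℝ) ^ 2) + h) := by ring

/-- **FINE near-cold estimate**: for every `η > 0` there are `r > 0` and `C ≥ 0` such that for every fine configuration `y` with
`D(y, 1) ≤ r`, every fine SZZ solution `U'` from `y` on any space and every lattice time `h`,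
`E wdisc_K(stepDown U'_h, stepDown y) ≤ η + C (h² + h)`. [folklore] -/
theorem integral_wdisc_stepDown_le_near_one (γ : ℝ) (K : ℕ) {η : ℝ} (hη : 0 < η) :
    ∃ r : ℝ, 0 < r ∧ ∃ C : ℝ, 0 ≤ C ∧ ∀ (y : GaugeConfig 3 ((F.P (K + 1)).sitesPerDir 0) G2),
      (∑ e, hsForm 2 ((fundamentalRep (Fin 2) (y e) : Matrix (Fin 2) (Fin 2) ℂ) - fundamentalRep (Fin 2) (1 : G2))
          ((fundamentalRep (Fin 2) (y e) : Matrix (Fin 2) (Fin 2) ℂ) - fundamentalRep (Fin 2) (1 : G2))) ≤ r →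
      ∀ (Ω : Type) [MeasurableSpace Ω] (P : Measure Ω) [IsProbabilityMeasure P]
        (W : ℝ≥0 → Ω → (Edge 3 ((F.P (K + 1)).sitesPerDir 0) × NoiseIdx 2 → ℝ)) (hW : IsFlatBrownian W P)
        (U' : ℝ≥0 → Ω → GaugeConfig 3 ((F.P (K + 1)).sitesPerDir 0) G2), (∀ ω, U' 0 ω = y) →
        (latticeLangevinDynamics su2Rep ((γ * (F.P (K + 1)).eps)⁻¹ / 2)).IsSolution (fundamentalRep (Fin 2))
          hW.natFiltration P W U' →
        ∀ h : ℝ≥0, ∫ ω, wdisc F K (stepDown F K (U' h ω)) (stepDown F K y) ∂P ≤ η + C * (((h : ℝ) ^ 2) + h) := by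
  haveI := Summit.QuantumFields.YangMills.Theorems.ColdStartUniversality.secondCountableTopology_su2
  haveI := Summit.QuantumFields.YangMills.Theorems.ColdStartUniversality.borelSpace_config ((F.P K).sitesPerDir 0)
  haveI := Summit.QuantumFields.YangMills.Theorems.ColdStartUniversality.borelSpace_config ((F.P (K + 1)).sitesPerDir 0)
  obtain ⟨rf, hrf, ρf, hρf, hmodf⟩ := exists_fine_cold_modulus F K hη
  obtain ⟨Cf, hCf0, hCf⟩ := Summit.QuantumFields.YangMills.Theorems.ColdStartUniversality.measureReal_hsDist_start_ge_le
    ((F.P (K + 1)).sitesPerDir 0) ((γ * (F.P (K + 1)).eps)⁻¹ / 2)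
  obtain ⟨ρ', hρ'def⟩ : ∃ ρ' : ℝ, ρ' = min ρf (rf / 4) := ⟨_, rfl⟩
  have hρ'1 : ρ' ≤ ρf := hρ'def ▸ min_le_left _ _
  have hρ'2 : ρ' ≤ rf / 4 := hρ'def ▸ min_le_right _ _
  have hρ'pos : 0 < ρ' := hρ'def ▸ lt_min hρf (by linarith)
  refine ⟨rf / 4, by linarith, 4 * (Cf / ρ'), by positivity, ?_⟩
  intro y hy Ω mΩ P hP W hW U' hU0 hU h
  have hmU : Measurable (U' h) := (hU.adapted h).mono (hW.natFiltration.le h) le_rfl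
  have hsmall : ∀ z : GaugeConfig 3 ((F.P (K + 1)).sitesPerDir 0) G2,
      (∑ e, hsForm 2 ((fundamentalRep (Fin 2) (z e) : Matrix (Fin 2) (Fin 2) ℂ) - fundamentalRep (Fin 2) (y e))
          ((fundamentalRep (Fin 2) (z e) : Matrix (Fin 2) (Fin 2) ℂ) - fundamentalRep (Fin 2) (y e))) < ρ' →
        wdisc F K (stepDown F K z) (stepDown F K y) < η := by
    intro z hz
    have hz1 := hsDist_le_two_mul_add z y (fun _ => (1 : G2))
    have hzball : (∑ e, hsForm 2 ((fundamentalRep (Fin 2) (z e) : Matrix (Fin 2) (Fin 2) ℂ) - fundamentalRep (Fin 2) (1 : G2))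
        ((fundamentalRep (Fin 2) (z e) : Matrix (Fin 2) (Fin 2) ℂ) - fundamentalRep (Fin 2) (1 : G2))) ≤ rf := by
      have h4 : _ < rf / 4 := lt_of_lt_of_le hz hρ'2
      linarith
    exact hmodf y z (hy.trans (by linarith)) hzball (lt_of_lt_of_le hz hρ'1)
  have hwm0 := (measurable_wdisc' F K).comp
    ((measurable_stepDown F K).prodMk (measurable_const (β := GaugeConfig 3 ((F.P (K + 1)).sitesPerDir 0) G2) (a := stepDown F K y)))
  have hwm : Measurable fun z : GaugeConfig 3 ((F.P (K + 1)).sitesPerDir 0) G2 => wdisc F K (stepDown F K z) (stepDown F K y) :=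
    hwm0
  have hdm : Measurable fun z : GaugeConfig 3 ((F.P (K + 1)).sitesPerDir 0) G2 => ∑ e, hsForm 2
      ((fundamentalRep (Fin 2) (z e) : Matrix (Fin 2) (Fin 2) ℂ) - fundamentalRep (Fin 2) (y e))
      ((fundamentalRep (Fin 2) (z e) : Matrix (Fin 2) (Fin 2) ℂ) - fundamentalRep (Fin 2) (y e)) :=
    (Summit.QuantumFields.YangMills.Theorems.ColdStartUniversality.continuous_hsDist continuous_id
      (continuous_const (y := y))).measurable
  have hE := integral_le_add_mul_measureReal (P := P) hmU hwm hdm (fun z => (wdisc_nonneg_le_four F K _ _).1)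
    (fun z => (wdisc_nonneg_le_four F K _ _).2) hη.le hsmall
  have hT := hCf y Ω P W hW U' hU0 hU h ρ' hρ'pos
  calc ∫ ω, wdisc F K (stepDown F K (U' h ω)) (stepDown F K y) ∂P ≤ η + 4 * P.real {ω | ρ' ≤ ∑ e, hsForm 2
        ((fundamentalRep (Fin 2) (U' h ω e) : Matrix (Fin 2) (Fin 2) ℂ) - fundamentalRep (Fin 2) (y e))
        ((fundamentalRep (Fin 2) (U' h ω e) : Matrix (Fin 2) (Fin 2) ℂ) - fundamentalRep (Fin 2) (y e))} := hE
    _ ≤ η + 4 * (Cf * (((h : ℝ) ^ 2) + h) / ρ') := by gcongr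
    _ = η + 4 * (Cf / ρ') * (((h : ℝ) ^ 2) + h) := by ring

end Summit.QuantumFields.YangMills.Cruxes.ColdStartContinuumCauchy.LindebergSwap

end
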